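import Mathlib
import Summits.NavierStokesRegularity.NavierStokesRegularity.Theorems.SubOnsagerCeilingVirtualFloorChainCoupledFace
import Summits.NavierStokesRegularity.NavierStokesRegularity.Theorems.SubOnsagerCeilingGapSpecCertK1
import Summits.NavierStokesRegularity.NavierStokesRegularity.Theorems.SubOnsagerCeilingGapSpecCertK2
import HarnessLib

/-!
# TOPOLOGY-AS-A-DATUM ROUTE, worked instance: the chain barrier on the slice `b ∈ [7/5, 141/100]` from the spec-list design `dK`
(helper file for crux stmt-NavierStokesRegularity-27057 `SubOnsagerCeiling.ForwardTailCeilingKP`, `--supports … --as helper`;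
LEAD SOC g12, line «kp-shell-barrier»)

Assembly for the slice `b ∈ [7/5, 141/100]` through the design-AND-topology-agnostic files `SubOnsagerCeilingGapSpec{,Kernel}`: (i) the rescaling
constants `L = b^(399/200)`, `p = b^(197/200)`, `b²` lie in the rational box of the certificates (`specSliceK_consts`); (ii) the `hFace`
hypothesis of `VirtualFloor.chain_le_of_coupledFaceCertB` (ι = `Fin 13`) for `fun k => (dK k).face` at every such `b`, from the kernel
certificates through `GapSpec.inertial_of_cert` (bound `−1/4096`) / `damping_of_cert`, structural damping signs by `Spec.face_damping`;
(iii) `hInit` by `design_init` (side conditions `Spec.InitOK` decided on the literal), `hSafe` by `design_safe`; (iv) the chain barrier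
`(b^(101/200))^(2k) Z_k(t)² ≤ 100 x₀²` along every honest non-negative `ν`-viscous Katz–Pavlović chain from a one-shell datum
(`spec_gap_chain_K`). HONEST FRAMING: MODEL lattice (route SubOnsagerCeiling, TL-M2Break); nothing here bears on Navier–Stokes regularity;
27057 stays OPEN. [cite: BarbatoMorandinRomito2011, §2 Lemma 2.1, §3.2] [cite: Tao2016AveragedNS, §4 (4.5), (4.13)]
-/

noncomputable section

-- the sub-problem namespace `NavierStokesRegularity.NavierStokesRegularity` is the tree's layout (D-0017)
set_option linter.dupNamespace false

namespace Summit.NavierStokesRegularity.NavierStokesRegularity.Theorems.VirtualFloor.GapSpec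

open Set Filter Topology
open Literature.Analysis.ValidatedNumerics KernelFaceMul KernelFaceAffine
open Summit.NavierStokesRegularity.NavierStokesRegularity.Theorems.VirtualFloor
open Summit.NavierStokesRegularity.NavierStokesRegularity.Theorems.VirtualFloor.GapRung (pt pt_mem_box9)

/-! ## Numerical facts: the rescaling constants of the slice lie in the certificates' box -/

/-- `19567/10000 ≤ (7/5)^(399/200)`. [folklore] -/
theorem specSliceK_L_lo : ((19567 / 10000 : ℚ) : ℝ) ≤ (7 / 5 : ℝ) ^ ((399 : ℝ) / 200) := by
  have h0 : (0 : ℝ) ≤ (7 / 5 : ℝ) ^ ((399 : ℝ) / 200) := by positivity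
  have h2 : ((7 / 5 : ℝ) ^ ((399 : ℝ) / 200)) ^ (200 : ℕ) = (7 / 5 : ℝ) ^ (399 : ℕ) := by
    rw [← Real.rpow_natCast, ← Real.rpow_mul (by norm_num)]
    norm_num
  have hq : ¬ ((7 / 5 : ℚ) ^ (399 : ℕ) < (19567 / 10000 : ℚ) ^ (200 : ℕ)) := by decide +kernel
  have hr : ¬ ((((7 / 5 : ℚ) ^ (399 : ℕ) : ℚ) : ℝ) < (((19567 / 10000 : ℚ) ^ (200 : ℕ) : ℚ) : ℝ)) := by
    rw [Rat.cast_lt]; exact hq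
  push_cast at hr
  push_cast
  by_contra h
  push Not at h
  have h3 : ((7 / 5 : ℝ) ^ ((399 : ℝ) / 200)) ^ (200 : ℕ) < (19567 / 10000 : ℝ) ^ (200 : ℕ) :=
    pow_lt_pow_left₀ h h0 (by norm_num)
  rw [h2] at h3
  exact hr h3

/-- `(141/100)^(399/200) ≤ 198469/100000`. [folklore] -/
theorem specSliceK_L_hi : (141 / 100 : ℝ) ^ ((399 : ℝ) / 200) ≤ ((198469 / 100000 : ℚ) : ℝ) := by
  have h0 : (0 : ℝ) ≤ (141 / 100 : ℝ) ^ ((399 : ℝ) / 200) := by positivity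
  have h2 : ((141 / 100 : ℝ) ^ ((399 : ℝ) / 200)) ^ (200 : ℕ) = (141 / 100 : ℝ) ^ (399 : ℕ) := by
    rw [← Real.rpow_natCast, ← Real.rpow_mul (by norm_num)]
    norm_num
  have hq : ¬ ((198469 / 100000 : ℚ) ^ (200 : ℕ) < (141 / 100 : ℚ) ^ (399 : ℕ)) := by decide +kernel
  have hr : ¬ ((((198469 / 100000 : ℚ) ^ (200 : ℕ) : ℚ) : ℝ) < (((141 / 100 : ℚ) ^ (399 : ℕ) : ℚ) : ℝ)) := by
    rw [Rat.cast_lt]; exact hq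
  push_cast at hr
  push_cast
  by_contra h
  push Not at h
  have h3 : (198469 / 100000 : ℝ) ^ (200 : ℕ) < ((141 / 100 : ℝ) ^ ((399 : ℝ) / 200)) ^ (200 : ℕ) :=
    pow_lt_pow_left₀ h (by norm_num) (by norm_num)
  rw [h2] at h3
  exact hr h3

/-- `27859/20000 ≤ (7/5)^(197/200)`. [folklore] -/
theorem specSliceK_p_lo : ((27859 / 20000 : ℚ) : ℝ) ≤ (7 / 5 : ℝ) ^ ((197 : ℝ) / 200) := by
  have h0 : (0 : ℝ) ≤ (7 / 5 : ℝ) ^ ((197 : ℝ) / 200) := by positivity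
  have h2 : ((7 / 5 : ℝ) ^ ((197 : ℝ) / 200)) ^ (200 : ℕ) = (7 / 5 : ℝ) ^ (197 : ℕ) := by
    rw [← Real.rpow_natCast, ← Real.rpow_mul (by norm_num)]
    norm_num
  have hq : ¬ ((7 / 5 : ℚ) ^ (197 : ℕ) < (27859 / 20000 : ℚ) ^ (200 : ℕ)) := by decide +kernel
  have hr : ¬ ((((7 / 5 : ℚ) ^ (197 : ℕ) : ℚ) : ℝ) < (((27859 / 20000 : ℚ) ^ (200 : ℕ) : ℚ) : ℝ)) := by
    rw [Rat.cast_lt]; exact hq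
  push_cast at hr
  push_cast
  by_contra h
  push Not at h
  have h3 : ((7 / 5 : ℝ) ^ ((197 : ℝ) / 200)) ^ (200 : ℕ) < (27859 / 20000 : ℝ) ^ (200 : ℕ) :=
    pow_lt_pow_left₀ h h0 (by norm_num)
  rw [h2] at h3
  exact hr h3

/-- `(141/100)^(197/200) ≤ 35069/25000`. [folklore] -/
theorem specSliceK_p_hi : (141 / 100 : ℝ) ^ ((197 : ℝ) / 200) ≤ ((35069 / 25000 : ℚ) : ℝ) := by
  have h0 : (0 : ℝ) ≤ (141 / 100 : ℝ) ^ ((197 : ℝ) / 200) := by positivity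
  have h2 : ((141 / 100 : ℝ) ^ ((197 : ℝ) / 200)) ^ (200 : ℕ) = (141 / 100 : ℝ) ^ (197 : ℕ) := by
    rw [← Real.rpow_natCast, ← Real.rpow_mul (by norm_num)]
    norm_num
  have hq : ¬ ((35069 / 25000 : ℚ) ^ (200 : ℕ) < (141 / 100 : ℚ) ^ (197 : ℕ)) := by decide +kernel
  have hr : ¬ ((((35069 / 25000 : ℚ) ^ (200 : ℕ) : ℚ) : ℝ) < (((141 / 100 : ℚ) ^ (197 : ℕ) : ℚ) : ℝ)) := by
    rw [Rat.cast_lt]; exact hq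
  push_cast at hr
  push_cast
  by_contra h
  push Not at h
  have h3 : (35069 / 25000 : ℝ) ^ (200 : ℕ) < ((141 / 100 : ℝ) ^ ((197 : ℝ) / 200)) ^ (200 : ℕ) :=
    pow_lt_pow_left₀ h (by norm_num) (by norm_num)
  rw [h2] at h3
  exact hr h3

/-- The three rescaling constants lie in the slice box. [folklore] -/
theorem specSliceK_consts {b : ℝ} (hb : (7 / 5 : ℝ) ≤ b) (hb' : b ≤ (141 / 100 : ℝ)) :
    (((19567 / 10000 : ℚ) : ℝ) ≤ (b ^ ((5 : ℝ) / 2) / b ^ ((101 : ℝ) / 200)) ∧ (b ^ ((5 : ℝ) / 2) / b ^ ((101 : ℝ) / 200)) ≤ ((198469 / 100000 : ℚ) : ℝ)) ∧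
    (((27859 / 20000 : ℚ) : ℝ) ≤ (b ^ ((5 : ℝ) / 2) / (b ^ ((101 : ℝ) / 200)) ^ 3) ∧ (b ^ ((5 : ℝ) / 2) / (b ^ ((101 : ℝ) / 200)) ^ 3) ≤ ((35069 / 25000 : ℚ) : ℝ)) ∧
    (((49 / 25 : ℚ) : ℝ) ≤ b ^ 2 ∧ b ^ 2 ≤ ((19881 / 10000 : ℚ) : ℝ)) := by
  have hb0 : 0 < b := by linarith
  have hL : (b ^ ((5 : ℝ) / 2) / b ^ ((101 : ℝ) / 200)) = b ^ ((399 : ℝ) / 200) := by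
    rw [← Real.rpow_sub hb0]; norm_num
  have hp : (b ^ ((5 : ℝ) / 2) / (b ^ ((101 : ℝ) / 200)) ^ 3) = b ^ ((197 : ℝ) / 200) := by
    rw [← Real.rpow_natCast, ← Real.rpow_mul hb0.le, ← Real.rpow_sub hb0]; norm_num
  rw [hL, hp]
  refine ⟨⟨specSliceK_L_lo.trans (Real.rpow_le_rpow (by norm_num) hb (by norm_num)),
    (Real.rpow_le_rpow hb0.le hb' (by norm_num)).trans specSliceK_L_hi⟩,
    ⟨specSliceK_p_lo.trans (Real.rpow_le_rpow (by norm_num) hb (by norm_num)),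
    (Real.rpow_le_rpow hb0.le hb' (by norm_num)).trans specSliceK_p_hi⟩, ?_, ?_⟩
  · push_cast; nlinarith
  · push_cast; nlinarith

/-! ## Region facts of the design -/

/-- Every face of `dK` satisfies `InitOK`. [folklore] -/
theorem dK_initOK : ∀ k, (dK k).InitOK := by
  intro k; fin_cases k
  · exact dK_initOK_0
  · exact dK_initOK_1
  · exact dK_initOK_2
  · exact dK_initOK_3
  · exact dK_initOK_4
  · exact dK_initOK_5
  · exact dK_initOK_6
  · exact dK_initOK_7
  · exact dK_initOK_8
  · exact dK_initOK_9
  · exact dK_initOK_10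
  · exact dK_initOK_11
  · exact dK_initOK_12

/-! ## The `hFace` hypothesis at every `b` of the slice -/

/-- **`hFace` for `dK` at every `b ∈ [7/5, 141/100]`.** [cite: BarbatoMorandinRomito2011, §2 Lemma 2.1] -/
theorem specSliceK_hFace {b : ℝ} (hb : (7 / 5 : ℝ) ≤ b) (hb' : b ≤ (141 / 100 : ℝ)) :
    ∀ k (x : Fin 4 → ℝ) (v z : ℝ), (∀ i, 0 ≤ x i) → 0 ≤ v → 0 ≤ z → (∀ i, x i ≤ (49 / 50 : ℝ)) → v ≤ (49 / 50 : ℝ) →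
      z ≤ (49 / 50 : ℝ) → (∀ k', (dK k').face x ≤ 0) → (∀ k', (dK k').face (vec4 v (x 0) (x 1) (x 2)) ≤ 0) →
      (∀ k', (dK k').face (vec4 (x 1) (x 2) (x 3) z) ≤ 0) → (dK k).face x = 0 →
      ((dK k).grad 0 x * (v ^ 2 - (b ^ ((5 : ℝ) / 2) / (b ^ ((101 : ℝ) / 200)) ^ 3) * x 0 * x 1) +
          (dK k).grad 1 x * ((b ^ ((5 : ℝ) / 2) / b ^ ((101 : ℝ) / 200)) * (x 0 ^ 2 - (b ^ ((5 : ℝ) / 2) / (b ^ ((101 : ℝ) / 200)) ^ 3) * x 1 * x 2)) +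
          (dK k).grad 2 x * ((b ^ ((5 : ℝ) / 2) / b ^ ((101 : ℝ) / 200)) ^ 2 * (x 1 ^ 2 - (b ^ ((5 : ℝ) / 2) / (b ^ ((101 : ℝ) / 200)) ^ 3) * x 2 * x 3)) +
          (dK k).grad 3 x * ((b ^ ((5 : ℝ) / 2) / b ^ ((101 : ℝ) / 200)) ^ 3 * (x 2 ^ 2 - (b ^ ((5 : ℝ) / 2) / (b ^ ((101 : ℝ) / 200)) ^ 3) * x 3 * z)) < 0) ∧
      0 ≤ (dK k).grad 0 x * x 0 + (dK k).grad 1 x * ((b ^ 2) * x 1) + (dK k).grad 2 x * ((b ^ 2) ^ 2 * x 2) +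
        (dK k).grad 3 x * ((b ^ 2) ^ 3 * x 3) := by
  intro k x v z h0 hv0 hz0 hc hvc hzc hX hLo hUp hk
  obtain ⟨hL, hp, hb2⟩ := specSliceK_consts hb hb'
  have hmem := pt_mem_box9 h0 hc hv0 hvc hz0 hzc hL hp hb2
  refine ⟨?_, ?_⟩
  · fin_cases k
    · exact inertial_of_cert (D := dK) (k := 0) dK_elimOK_0 cert_dK_K_cap1 (by norm_num) hmem h0 hc hX hLo hUp hk
    · exact inertial_of_cert (D := dK) (k := 1) dK_elimOK_1 cert_dK_K_cap2 (by norm_num) hmem h0 hc hX hLo hUp hk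
    · exact inertial_of_cert (D := dK) (k := 2) dK_elimOK_2 cert_dK_K_cap3 (by norm_num) hmem h0 hc hX hLo hUp hk
    · rcases Box.mem_split hmem 0 (49/100) with hmem' | hmem'
      · exact inertial_of_cert (D := dK) (k := 3) dK_elimOK_3 cert_dK_K_cub0_1 (by norm_num) hmem' h0 hc hX hLo hUp hk
      · rcases Box.mem_split hmem' 0 (147/200) with hmem'' | hmem''
        · exact inertial_of_cert (D := dK) (k := 3) dK_elimOK_3 cert_dK_K_cub0_2 (by norm_num) hmem'' h0 hc hX hLo hUp hk
        · exact inertial_of_cert (D := dK) (k := 3) dK_elimOK_3 cert_dK_K_cub0_3 (by norm_num) hmem'' h0 hc hX hLo hUp hk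
    · exact inertial_of_cert (D := dK) (k := 4) dK_elimOK_4 cert_dK_K_cub1 (by norm_num) hmem h0 hc hX hLo hUp hk
    · exact inertial_of_cert (D := dK) (k := 5) dK_elimOK_5 cert_dK_K_cub2 (by norm_num) hmem h0 hc hX hLo hUp hk
    · exact inertial_of_cert (D := dK) (k := 6) dK_elimOK_6 cert_dK_K_capA (by norm_num) hmem h0 hc hX hLo hUp hk
    · exact inertial_of_cert (D := dK) (k := 7) dK_elimOK_7 cert_dK_K_capB (by norm_num) hmem h0 hc hX hLo hUp hk
    · rcases Box.mem_split hmem 2 (49/100) with hmem' | hmem'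
      · exact inertial_of_cert (D := dK) (k := 8) dK_elimOK_8 cert_dK_K_bulk_1 (by norm_num) hmem' h0 hc hX hLo hUp hk
      · rcases Box.mem_split hmem' 2 (147/200) with hmem'' | hmem''
        · exact inertial_of_cert (D := dK) (k := 8) dK_elimOK_8 cert_dK_K_bulk_2 (by norm_num) hmem'' h0 hc hX hLo hUp hk
        · exact inertial_of_cert (D := dK) (k := 8) dK_elimOK_8 cert_dK_K_bulk_3 (by norm_num) hmem'' h0 hc hX hLo hUp hk
    · rcases Box.mem_split hmem 2 (49/100) with hmem' | hmem'
      · exact inertial_of_cert (D := dK) (k := 9) dK_elimOK_9 cert_dK_K_carve_1 (by norm_num) hmem' h0 hc hX hLo hUp hk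
      · rcases Box.mem_split hmem' 2 (147/200) with hmem'' | hmem''
        · rcases Box.mem_split hmem'' 5 (49/100) with hmem''' | hmem'''
          · exact inertial_of_cert (D := dK) (k := 9) dK_elimOK_9 cert_dK_K_carve_2 (by norm_num) hmem''' h0 hc hX hLo hUp hk
          · exact inertial_of_cert (D := dK) (k := 9) dK_elimOK_9 cert_dK_K_carve_3 (by norm_num) hmem''' h0 hc hX hLo hUp hk
        · rcases Box.mem_split hmem'' 2 (343/400) with hmem''' | hmem'''
          · rcases Box.mem_split hmem''' 5 (49/100) with hmem'''' | hmem''''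
            · exact inertial_of_cert (D := dK) (k := 9) dK_elimOK_9 cert_dK_K_carve_4 (by norm_num) hmem'''' h0 hc hX hLo hUp hk
            · rcases Box.mem_split hmem'''' 0 (49/100) with hmem''''' | hmem'''''
              · exact inertial_of_cert (D := dK) (k := 9) dK_elimOK_9 cert_dK_K_carve_5 (by norm_num) hmem''''' h0 hc hX hLo hUp hk
              · rcases Box.mem_split hmem''''' 2 (637/800) with hmem'''''' | hmem''''''
                · exact inertial_of_cert (D := dK) (k := 9) dK_elimOK_9 cert_dK_K_carve_6 (by norm_num) hmem'''''' h0 hc hX hLo hUp hk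
                · exact inertial_of_cert (D := dK) (k := 9) dK_elimOK_9 cert_dK_K_carve_7 (by norm_num) hmem'''''' h0 hc hX hLo hUp hk
          · exact inertial_of_cert (D := dK) (k := 9) dK_elimOK_9 cert_dK_K_carve_8 (by norm_num) hmem''' h0 hc hX hLo hUp hk
    · exact inertial_of_cert (D := dK) (k := 10) dK_elimOK_10 cert_dK_K_rat0 (by norm_num) hmem h0 hc hX hLo hUp hk
    · exact inertial_of_cert (D := dK) (k := 11) dK_elimOK_11 cert_dK_K_rat1 (by norm_num) hmem h0 hc hX hLo hUp hk
    · exact inertial_of_cert (D := dK) (k := 12) dK_elimOK_12 cert_dK_K_rat2 (by norm_num) hmem h0 hc hX hLo hUp hk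
  · have hB20 : (0 : ℝ) ≤ b ^ 2 := by positivity
    have hB23 : b ^ 2 ≤ 3 := by nlinarith
    fin_cases k
    · exact Spec.face_damping (dK 0) dK_dampOK_0 x (b ^ 2) h0 hB20 hB23 hk
    · exact Spec.face_damping (dK 1) dK_dampOK_1 x (b ^ 2) h0 hB20 hB23 hk
    · exact Spec.face_damping (dK 2) dK_dampOK_2 x (b ^ 2) h0 hB20 hB23 hk
    · exact Spec.face_damping (dK 3) dK_dampOK_3 x (b ^ 2) h0 hB20 hB23 hk
    · exact Spec.face_damping (dK 4) dK_dampOK_4 x (b ^ 2) h0 hB20 hB23 hk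
    · exact Spec.face_damping (dK 5) dK_dampOK_5 x (b ^ 2) h0 hB20 hB23 hk
    · exact Spec.face_damping (dK 6) dK_dampOK_6 x (b ^ 2) h0 hB20 hB23 hk
    · exact Spec.face_damping (dK 7) dK_dampOK_7 x (b ^ 2) h0 hB20 hB23 hk
    · exact damping_of_cert (D := dK) (k := 8) dK_elimOK_8 cert_dK_K_bulk_damp hmem h0 hc hX hLo hUp hk
    · exact damping_of_cert (D := dK) (k := 9) dK_elimOK_9 cert_dK_K_carve_damp hmem h0 hc hX hLo hUp hk
    · exact damping_of_cert (D := dK) (k := 10) dK_elimOK_10 cert_dK_K_rat0_damp hmem h0 hc hX hLo hUp hk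
    · exact damping_of_cert (D := dK) (k := 11) dK_elimOK_11 cert_dK_K_rat1_damp hmem h0 hc hX hLo hUp hk
    · exact damping_of_cert (D := dK) (k := 12) dK_elimOK_12 cert_dK_K_rat2_damp hmem h0 hc hX hLo hUp hk

/-! ## The chain barrier on the slice -/

/-- **The ν-uniform chain barrier `θ = 101/200` at every `b ∈ [7/5, 141/100]`** (spec-list design `dK`).
[cite: BarbatoMorandinRomito2011, §3.2 (the rescaling)] [cite: Tao2016AveragedNS, §4 (4.5), (4.13)] -/
theorem spec_gap_chain_K {b c₀ ν s x₀ : ℝ} (hb : (7 / 5 : ℝ) ≤ b) (hb' : b ≤ (141 / 100 : ℝ)) (hc₀ : 0 < c₀)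
    (hν : 0 < ν) (hs : 0 < s) {Z : ℤ → ℝ → ℝ}
    (hdat : ∀ k : ℤ, Z k 0 = if k = 0 then x₀ else 0)
    (hvan : ∀ t, Z (-1) t = 0)
    (hbdd : ∃ M : ℝ, ∀ (t : ℝ) (k : ℕ), (1 + b ^ ((10 : ℝ) * k)) * |Z k t| ≤ M)
    (hcont : ∀ k : ℕ, ContinuousOn (Z k) (Icc 0 s))
    (hode : ∀ k : ℕ, ∀ t ∈ Icc 0 s, HasDerivWithinAt (Z k)
      (c₀ * (b ^ ((5 : ℝ) * ((k : ℝ) - 1) / 2) * Z ((k : ℤ) - 1) t ^ 2 -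
          b ^ ((5 : ℝ) * (k : ℝ) / 2) * (Z k t * Z ((k : ℤ) + 1) t)) -
        ν * b ^ ((2 : ℝ) * (k : ℝ)) * Z k t) (Icc 0 s) t)
    (hnn : ∀ t ∈ Icc 0 s, ∀ k : ℕ, 1 ≤ k → 0 ≤ Z k t) :
    ∀ t ∈ Icc 0 s, ∀ k : ℕ, (b ^ ((101 : ℝ) / 200)) ^ (2 * k) * Z k t ^ 2 ≤ 100 * x₀ ^ 2 :=
  chain_le_of_coupledFaceCertB (g := fun k => (dK k).face) (dg := fun k => (dK k).grad)
    (by linarith) (by linarith) hc₀ (by norm_num : (49 / 50 : ℝ) ≤ 1) hν hs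
    (fun k => (dK k).face_continuous) (fun k => (dK k).face_hasDerivWithinAt)
    (design_init dK dK_initOK) (design_safe dK 2 ((49/50)) rfl (by norm_num)) (specSliceK_hFace hb hb')
    hdat hvan hbdd hcont hode hnn

end Summit.NavierStokesRegularity.NavierStokesRegularity.Theorems.VirtualFloor.GapSpec

end
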